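import Literature.NumberTheory.GaloisCohomology.Howard2004.ResidualLevelControlProofs
import Literature.NumberTheory.GaloisCohomology.Howard2004.DVRSettingChebotarevEigenclassesProofs
import Literature.NumberTheory.GaloisCohomology.Howard2004.KolyvaginSystemScalars
import HarnessLib

/-!
# Howard 2004, Lemma 1.3.3 between `T̄` and a level `T^{(k)}` — the readings Lemma 1.6.4's proof consumes:
# `R_k`-linearity of `H¹(K, ι)`, LOCAL injectivity at primes with trivial action, and
# `H¹_{F̄(n)}(K, T̄) ≃ H¹_{F(n)}(K, T^{(k)})[𝔪]` as an additive bijection (theorems only)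

Topic `NumberTheory/GaloisCohomology/Howard2004` (sequel to `ResidualLevelControlProofs`: the residual inclusion
`ι : T̄ → T^{(k)}`, `ι ∘ π̄_k = π^{e_k-1}`, `H¹(K, ι)` injective with image the `π`-torsion, Selmer-compatible).
THEOREMS ONLY: no definition, no named fact, no instance, no notation, no `sorry`.

WHY (INPUTS row G87 = `Howard2004.thm161_dvrKolyvaginBound` = Howard Thm. 1.6.1; stub `stub_h161` of the μ-crux
stmt-BirchSwinnertonDyer-22642; cell `pub/bsd-print-x9`, seat `bsd-line-x10b-p1-w8` g10).  In the proof of Lemma 1.6.4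
(arXiv:1202.6340 Lemma 2.6.4, p. 12 L2–9, L19–24) a non-zero `d ∈ H¹_{F(n)}(K, T^{(k)})[𝔪]` is read as a class of
`H¹_{F(n)}(K, T̄)`, Lemma 1.6.2 (kernel theorem `DVRSetting.exists_mem_primes_localization_ne_zero` of
`DVRSettingChebotarevEigenclassesProofs`) produces a Kolyvagin prime `ℓ ∈ 𝓛^{(2k-1)}` with `loc_λ` of that RESIDUAL class
non-zero, and the argument continues with `loc_ℓ(d) ≠ 0` at the LEVEL `k`.  The passage back needs `H¹(K_λ, ι)`
injective; it is, because at a prime of `𝓛^{(k)}` the local Galois group acts trivially on `T^{(k)}` (Def. 1.2.1,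
`𝓛 ⊂ 𝓛₀(T)` unramified with `Frob_λ ≡ 1`; tree `trivial_toLocal_of_mem_primes`).  And «By Lemma (H.5 application),
`ρ(n) = 0` or `1` implies `Stub^{(k)}(n) = H¹_{F(n)}(K, T^{(k)})`» (p. 11 L95–97) reads `ρ(n) = dim H¹_{F(n)}(K, T̄)` as
the length of `H¹_{F(n)}(K, T^{(k)})[𝔪]` — an `R_k`-linear identification.

* §1 `cohomologyMap_residualInclusion_scalarMapH1` — `H¹(K, ι)` commutes with the scalars of `R_k`
  (`H¹(ι)(a · c̄) = a · H¹(ι) c̄`; `T̄` is `R_k`-linear by `DVRSetting.isScalarLinear_rhobar`), and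
  `scalarMapH1_residual_eq_zero_of_mem_maximalIdeal` — `𝔪_{R_k}` kills `H¹(K, T̄)` (so `H¹_{F̄(n)}(K, T̄)` is an
  `R_k/𝔪`-vector space); `scalarMapH1_algebraMap_eq` — the `R`- and `R_k`-scalar actions on `H¹(K, T^{(k)})` agree.
* §2 **`localCohomologyMap_residualInclusion_injective_of_trivial`** — `H¹(K_v, ι) : H¹(K_v, T̄) → H¹(K_v, T^{(k)})` is
  injective at a finite place where `Γ_{K_v}` acts trivially on `T^{(k)}` (cocycles are homomorphisms, coboundaries
  vanish, `ι` is injective); **`localization_cohomologyMap_residualInclusion_eq_zero_iff`** —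
  `loc_v (H¹(ι) c̄) = 0 ↔ loc_v c̄ = 0` there; `localization_cohomologyMap_residualInclusion_eq_zero` (the
  unconditional direction at every place).
* §3 **`exists_addEquiv_selmerGroup_residual`** / **`exists_addEquiv_selmerGroup_residual_atLevel`** — the additive
  bijection `H¹_{F̄}(K, T̄) ≃+ H¹_F(K, T^{(k)}) ⊓ ker(π·)` (resp. for `F(n)`, under `htriv`) whose underlying map is
  `H¹(K, ι)` (with §1 it is `R_k`-linear for the functorial module structures `galoisCohomology.moduleH1`).

HONEST FRAMING: `thm161_dvrKolyvaginBound` is NOT proved; the instantiation of Lemma 1.6.4's induction is not done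
here; no summit statement is proved; the Birch–Swinnerton-Dyer conjecture is not proved by any of this.
References: [Howard2004HeegnerKolyvagin] Lemma 1.3.3, Def. 1.2.1, Lemma 1.6.2, Lemma 1.6.4 (arXiv p. 7 L152–160, p. 6
L54–68, p. 11 L40–60, p. 11 L95 – p. 12 L27); [MazurRubinMemoirs2004] Lemma 3.5.4; [SerreGaloisCohomology1997] I §2.2,
I §5.1.
-/

set_option autoImplicit false

noncomputable section

open Function NumberField IsDedekindDomain Field
open scoped NumberField ContRepresentation

namespace Literature.NumberTheory.GaloisCohomology.Howard2004

open CategoryTheory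
open Literature.NumberTheory.GaloisRepresentations
open Literature.NumberTheory.GaloisRepresentations.DiscreteGaloisModule

namespace DVRSetting

variable {p : ℕ} [Fact p.Prime] {K : Type} [Field K] [NumberField K]
  {R : Type} [CommRing R] [IsDomain R] [IsDiscreteValuationRing R] [Algebra ℤ_[p] R]
  {N : ℕ → Type} [∀ k, AddCommGroup (N k)] [∀ k, TopologicalSpace (N k)]
  [∀ k, DiscreteTopology (N k)] [∀ k, Module R (N k)]
  {Rk : ℕ → Type} [∀ k, CommRing (Rk k)] [∀ k, IsLocalRing (Rk k)] [∀ k, TopologicalSpace (Rk k)]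
  [∀ k, DiscreteTopology (Rk k)] [∀ k, Algebra ℤ_[p] (Rk k)] [∀ k, Algebra R (Rk k)]
  [∀ k, Module (Rk k) (N k)] [∀ k, IsScalarTower R (Rk k) (N k)]
  {Nbar : Type} [AddCommGroup Nbar] [TopologicalSpace Nbar] [DiscreteTopology Nbar]
  [∀ k, Module (Rk k) Nbar]
  {Nq : ℕ → Finset (HeightOneSpectrum (𝓞 K)) → Type} [∀ k n, AddCommGroup (Nq k n)]
  [∀ k n, TopologicalSpace (Nq k n)] [∀ k n, DiscreteTopology (Nq k n)]
  [∀ k n, Module (Rk k) (Nq k n)] [∀ k n, Module R (Nq k n)]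
  [∀ k n, IsScalarTower R (Rk k) (Nq k n)]
  (S : DVRSetting p K R N Rk Nbar Nq)

/-! ## §1 `H¹(K, ι)` and the scalars -/

/-- **`H¹(K, ι)` is `R_k`-linear**: `H¹(ι)(a · c̄) = a · H¹(ι) c̄` for the functorial scalar actions `H¹(a ·)` on
`H¹(K, T̄)` (`T̄` is `R_k`-linear, `isScalarLinear_rhobar`) and on `H¹(K, T^{(k)})` (`SatisfiesH.scalarLinear`).
[cite: Howard2004HeegnerKolyvagin, §1 conventions `Mod_{R,K}` and Lemma 1.3.3 (arXiv p. 5 L3–24, p. 7 L152–160)] -/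
theorem cohomologyMap_residualInclusion_scalarMapH1 (hy : S.SatisfiesH) (k : ℕ) (ι : Nbar →ₗ[Rk k] N k)
    (hequiv : ∀ (σ : absoluteGaloisGroup K) (x : Nbar), ι (S.ρbar σ x) = S.T.ρ k σ (ι x))
    (a : Rk k) (c : galoisCohomology S.ρbar 1) :
    ContinuousRep.cohomologyMap S.ρbar (S.T.ρ k) ι.toAddMonoidHom continuous_of_discreteTopology hequiv 1
        (galoisCohomology.scalarMapH1 S.ρbar (S.isScalarLinear_rhobar hy k) a c) =
      galoisCohomology.scalarMapH1 (S.T.ρ k) (hy.scalarLinear k) a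
        (ContinuousRep.cohomologyMap S.ρbar (S.T.ρ k) ι.toAddMonoidHom continuous_of_discreteTopology
          hequiv 1 c) :=
  cohomologyMap_scalarMapH1 (S.isScalarLinear_rhobar hy k) (hy.scalarLinear k) ι hequiv a c

/-- **`𝔪_{R_k}` kills `H¹(K, T̄)`**: `H¹(a ·) = 0` on `H¹(K, T̄)` for `a ∈ 𝔪_{R_k}` (`𝔪 T̄ = 0`), so every subgroup of
`H¹(K, T̄)` is an `R_k/𝔪`-vector space for the functorial structure.
[cite: Howard2004HeegnerKolyvagin, H.1 and Def. 1.5.2 (arXiv p. 7 L59; p. 9 L134–138: «the `R/𝔪`-dimension of `𝓗̄(n)^±`»)] -/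
theorem scalarMapH1_residual_eq_zero_of_mem_maximalIdeal (hy : S.SatisfiesH) (k : ℕ) {a : Rk k}
    (ha : a ∈ IsLocalRing.maximalIdeal (Rk k)) (c : galoisCohomology S.ρbar 1) :
    galoisCohomology.scalarMapH1 S.ρbar (S.isScalarLinear_rhobar hy k) a c = 0 :=
  galoisCohomology.smul_eq_zero_of_forall S.ρbar (S.isScalarLinear_rhobar hy k) a
    (fun x => S.maximalIdeal_smul_residual_eq_zero hy k ha x) c

/-- **The `R`- and `R_k`-scalar actions on `H¹(K, T^{(k)})` agree**: `H¹(r ·) = H¹(algebraMap r ·)` (the scalar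
tower `R → R_k → End T^{(k)}`), so statements in either currency interchange.
[cite: Howard2004HeegnerKolyvagin, §1.6 (arXiv p. 11 L33–38: `T^{(k)}` an `R_k = R/𝔪^k`-module)] -/
theorem scalarMapH1_algebraMap_eq (hy : S.SatisfiesH) (k : ℕ) (r : R) (c : galoisCohomology (S.T.ρ k) 1) :
    galoisCohomology.scalarMapH1 (S.T.ρ k) (hy.scalarLinear k) (algebraMap R (Rk k) r) c =
      galoisCohomology.scalarMapH1 (S.T.ρ k) (S.T.hlin k) r c := by
  obtain ⟨z, rfl⟩ := oneCocycleClass_surjective (S.T.ρ k).toTopRep c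
  rw [galoisCohomology.scalarMapH1_oneCocycleClass, galoisCohomology.scalarMapH1_oneCocycleClass]
  congr 1
  refine Subtype.ext (ContinuousMap.ext fun g => ?_)
  change algebraMap R (Rk k) r • z.1 g = r • z.1 g
  rw [algebraMap_smul]

/-! ## §2 `H¹(K_v, ι)` is injective where `Γ_{K_v}` acts trivially on `T^{(k)}` -/

/-- **`H¹(K_v, ι) : H¹(K_v, T̄) → H¹(K_v, T^{(k)})` is injective at a finite place `v` where `Γ_{K_v}` acts trivially
on `T^{(k)}`** (e.g. `v ∈ 𝓛^{(k)}`: unramified of degree two with `Frob_v ≡ 1` on `T^{(k)}`): a class of `H¹(K_v, T̄)`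
whose image is a coboundary `g ↦ g w - w = 0` has a representing cocycle `φ̄` with `ι ∘ φ̄ = 0`, i.e. `φ̄ = 0`.
[cite: Howard2004HeegnerKolyvagin, Def. 1.2.1 and Lemma 1.6.4 proof (arXiv p. 6 L54–68, p. 12 L2–9: «`loc_ℓ(d) ≠ 0`» for `d ∈ H¹_{F(n)}(K,T^{(k)})[𝔪]`)] [cite: SerreGaloisCohomology1997, I §5.1] -/
theorem localCohomologyMap_residualInclusion_injective_of_trivial (hy : S.SatisfiesH) (k : ℕ)
    (ι : Nbar →ₗ[Rk k] N k) (hι : ∀ y : N k, ι (S.πbar k y) = S.π ^ (S.e k - 1) • y)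
    (hequiv : ∀ (σ : absoluteGaloisGroup K) (x : Nbar), ι (S.ρbar σ x) = S.T.ρ k σ (ι x))
    (v : HeightOneSpectrum (𝓞 K))
    (htrivv : ∀ (g : absoluteGaloisGroup (v.adicCompletion K)) (y : N k), GaloisRep.toLocal v (S.T.ρ k) g y = y) :
    Function.Injective (ContinuousRep.cohomologyMap (S.ρbar.toLocal (Sum.inr v)) ((S.T.ρ k).toLocal (Sum.inr v))
      ι.toAddMonoidHom continuous_of_discreteTopology (fun _ x => hequiv _ x) 1) := by
  have hinj := S.residualInclusion_injective hy k ι hι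
  refine (injective_iff_map_eq_zero _).2 fun c hc => ?_
  obtain ⟨z, rfl⟩ := oneCocycleClass_surjective _ c
  have hc' := hc
  rw [cohomologyMap_one_oneCocycleClass (F := Place.Completion (Sum.inr v : Place K))] at hc'
  obtain ⟨w, hw⟩ := (oneCocycleClass_eq_zero_iff _ _).1 hc'
  refine (oneCocycleClass_eq_zero_iff _ _).2 ⟨0, fun g => ?_⟩
  have h : ι (z.1 g) = GaloisRep.toLocal v (S.T.ρ k) g w - w := hw g
  rw [htrivv, sub_self] at h
  rw [map_zero, sub_zero]
  exact (map_eq_zero_iff _ hinj).1 h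

/-- `loc_v c̄ = 0 ⇒ loc_v (H¹(ι) c̄) = 0` at every place (localisation commutes with `H¹(ι)`).
[cite: Howard2004HeegnerKolyvagin, Lemma 1.3.3 (arXiv p. 7 L152–160)] [cite: SerreGaloisCohomology1997, I §2.4] -/
theorem localization_cohomologyMap_residualInclusion_eq_zero (k : ℕ) (ι : Nbar →ₗ[Rk k] N k)
    (hequiv : ∀ (σ : absoluteGaloisGroup K) (x : Nbar), ι (S.ρbar σ x) = S.T.ρ k σ (ι x))
    (v : Place K) {c : galoisCohomology S.ρbar 1} (hc : galoisCohomology.localization S.ρbar v 1 c = 0) :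
    galoisCohomology.localization (S.T.ρ k) v 1
        (ContinuousRep.cohomologyMap S.ρbar (S.T.ρ k) ι.toAddMonoidHom continuous_of_discreteTopology
          hequiv 1 c) = 0 := by
  rw [localization_cohomologyMap_one, hc]
  exact map_zero _

/-- **`loc_v (H¹(ι) c̄) = 0 ↔ loc_v c̄ = 0` at a finite place where `Γ_{K_v}` acts trivially on `T^{(k)}`** — the
non-vanishing of a localisation passes between `d = H¹(ι) c̄ ∈ H¹(K, T^{(k)})[𝔪]` and the residual class `c̄` (as in
Case i/ii of the proof of Lemma 1.6.4, with Lemma 1.6.2 supplying the prime for `c̄`).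
[cite: Howard2004HeegnerKolyvagin, Lemma 1.6.4 proof (arXiv p. 12 L2–9 and L19–24)] [cite: SerreGaloisCohomology1997, I §2.4] -/
theorem localization_cohomologyMap_residualInclusion_eq_zero_iff (hy : S.SatisfiesH) (k : ℕ)
    (ι : Nbar →ₗ[Rk k] N k) (hι : ∀ y : N k, ι (S.πbar k y) = S.π ^ (S.e k - 1) • y)
    (hequiv : ∀ (σ : absoluteGaloisGroup K) (x : Nbar), ι (S.ρbar σ x) = S.T.ρ k σ (ι x))
    (v : HeightOneSpectrum (𝓞 K))
    (htrivv : ∀ (g : absoluteGaloisGroup (v.adicCompletion K)) (y : N k), GaloisRep.toLocal v (S.T.ρ k) g y = y)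
    (c : galoisCohomology S.ρbar 1) :
    galoisCohomology.localization (S.T.ρ k) (Sum.inr v) 1
        (ContinuousRep.cohomologyMap S.ρbar (S.T.ρ k) ι.toAddMonoidHom continuous_of_discreteTopology
          hequiv 1 c) = 0 ↔
      galoisCohomology.localization S.ρbar (Sum.inr v) 1 c = 0 := by
  refine ⟨fun h => ?_, S.localization_cohomologyMap_residualInclusion_eq_zero k ι hequiv (Sum.inr v)⟩
  rw [localization_cohomologyMap_one] at h
  apply S.localCohomologyMap_residualInclusion_injective_of_trivial hy k ι hι hequiv v htrivv
  rw [h]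
  exact (map_zero _).symm

/-! ## §3 `H¹_{F̄(n)}(K, T̄) ≃+ H¹_{F(n)}(K, T^{(k)})[𝔪]` -/

/-- **The additive bijection `H¹_{F̄}(K, T̄) ≃+ H¹_F(K, T^{(k)}) ⊓ ker(π ·)` whose underlying map is `H¹(K, ι)`**
(`F̄` = `F_k` propagated along `π̄_k`); with §1 it is `R_k`-linear for the functorial module structures, so
`len_{R_k} H¹_F(K, T^{(k)})[𝔪] = len_{R_k} H¹_{F̄}(K, T̄) = dim_{R_k/𝔪} H¹_{F̄}(K, T̄)`.
[cite: Howard2004HeegnerKolyvagin, Lemma 1.3.3 (arXiv Lemma 2.3.3, p. 7 L152–160)] [cite: MazurRubinMemoirs2004, Lemma 3.5.4] -/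
theorem exists_addEquiv_selmerGroup_residual (hy : S.SatisfiesH) (k : ℕ) (ι : Nbar →ₗ[Rk k] N k)
    (hι : ∀ y : N k, ι (S.πbar k y) = S.π ^ (S.e k - 1) • y)
    (hequiv : ∀ (σ : absoluteGaloisGroup K) (x : Nbar), ι (S.ρbar σ x) = S.T.ρ k σ (ι x)) :
    ∃ Θ : ↥(((hy.h1 k).1.propagateStructure (S.t k).cond).selmerGroup) ≃+
        ↥(((S.t k).cond).selmerGroup ⊓ (galoisCohomology.scalarMapH1 (S.T.ρ k) (S.T.hlin k) S.π).ker),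
      ∀ c, (Θ c : galoisCohomology (S.T.ρ k) 1) =
        ContinuousRep.cohomologyMap S.ρbar (S.T.ρ k) ι.toAddMonoidHom continuous_of_discreteTopology hequiv 1
          (c : galoisCohomology S.ρbar 1) := by
  set H1ι := ContinuousRep.cohomologyMap S.ρbar (S.T.ρ k) ι.toAddMonoidHom continuous_of_discreteTopology
    hequiv 1 with hH1ι
  have himage := S.map_cohomologyMap_residualInclusion_selmerGroup_eq hy k ι hι hequiv
  let f : ↥(((hy.h1 k).1.propagateStructure (S.t k).cond).selmerGroup) →+
      ↥(((S.t k).cond).selmerGroup ⊓ (galoisCohomology.scalarMapH1 (S.T.ρ k) (S.T.hlin k) S.π).ker) :=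
    { toFun := fun c => ⟨H1ι (c : galoisCohomology S.ρbar 1), himage ▸ AddSubgroup.mem_map_of_mem _ c.2⟩
      map_zero' := Subtype.ext (map_zero _)
      map_add' := fun a b => Subtype.ext (map_add _ _ _) }
  have hf : Function.Bijective f := by
    constructor
    · intro a b hab
      exact Subtype.ext (S.cohomologyMap_residualInclusion_injective hy k ι hι hequiv
        (congrArg Subtype.val hab))
    · rintro ⟨d, hd⟩
      rw [← himage] at hd
      obtain ⟨c, hc, rfl⟩ := hd
      exact ⟨⟨c, hc⟩, rfl⟩
  exact ⟨AddEquiv.ofBijective f hf, fun c => rfl⟩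

/-- **The same for `F(n)`: `H¹_{F̄(n)}(K, T̄) ≃+ H¹_{F(n)}(K, T^{(k)}) ⊓ ker(π ·)` with underlying map `H¹(K, ι)`**, for
`n` a finite set of primes at which `Γ_L` acts trivially on `T^{(k)}` (`n ∈ 𝓝^{(k)}`) — the «(H.5 application)»
identification `H¹_{F(n)}(K, T̄) ≅ H¹_{F(n)}(K, T^{(k)})[𝔪]` of Lemma 1.6.4's proof as a bijection (so
`ρ(n) = dim H¹_{F(n)}(K, T̄)` is the length of the socle `H¹_{F(n)}(K, T^{(k)})[𝔪]`).
[cite: Howard2004HeegnerKolyvagin, Lemma 1.3.3 with Lemma 1.5.1, Lemma 1.6.4 proof (arXiv p. 7 L152–160, p. 9 L127–133, p. 11 L95–97)] [cite: MazurRubinMemoirs2004, Lemma 3.5.4] -/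
theorem exists_addEquiv_selmerGroup_residual_atLevel (hy : S.SatisfiesH) (k : ℕ) (ι : Nbar →ₗ[Rk k] N k)
    (hι : ∀ y : N k, ι (S.πbar k y) = S.π ^ (S.e k - 1) • y)
    (hequiv : ∀ (σ : absoluteGaloisGroup K) (x : Nbar), ι (S.ρbar σ x) = S.T.ρ k σ (ι x))
    (n : Finset (HeightOneSpectrum (𝓞 K)))
    (htriv : ∀ w ∈ n, ∀ g ∈ transverseFixer p (residueChar w) S.jbar w, ∀ y : N k,
      GaloisRep.toLocal w (S.T.ρ k) g y = y) :
    ∃ Θ : ↥((((hy.h1 k).1.propagateStructure (S.t k).cond).modify (transverseStructure p S.ρbar S.jbar)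
          ∅ ∅ n).selmerGroup) ≃+
        ↥((((S.t k).atLevel S.jbar n).cond).selmerGroup ⊓
          (galoisCohomology.scalarMapH1 (S.T.ρ k) (S.T.hlin k) S.π).ker),
      ∀ c, (Θ c : galoisCohomology (S.T.ρ k) 1) =
        ContinuousRep.cohomologyMap S.ρbar (S.T.ρ k) ι.toAddMonoidHom continuous_of_discreteTopology hequiv 1
          (c : galoisCohomology S.ρbar 1) := by
  set H1ι := ContinuousRep.cohomologyMap S.ρbar (S.T.ρ k) ι.toAddMonoidHom continuous_of_discreteTopology
    hequiv 1 with hH1ι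
  have himage := S.map_cohomologyMap_residualInclusion_selmerGroup_atLevel_eq hy k ι hι hequiv n htriv
  let f : ↥((((hy.h1 k).1.propagateStructure (S.t k).cond).modify (transverseStructure p S.ρbar S.jbar)
          ∅ ∅ n).selmerGroup) →+
      ↥((((S.t k).atLevel S.jbar n).cond).selmerGroup ⊓
        (galoisCohomology.scalarMapH1 (S.T.ρ k) (S.T.hlin k) S.π).ker) :=
    { toFun := fun c => ⟨H1ι (c : galoisCohomology S.ρbar 1), himage ▸ AddSubgroup.mem_map_of_mem _ c.2⟩
      map_zero' := Subtype.ext (map_zero _)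
      map_add' := fun a b => Subtype.ext (map_add _ _ _) }
  have hf : Function.Bijective f := by
    constructor
    · intro a b hab
      exact Subtype.ext (S.cohomologyMap_residualInclusion_injective hy k ι hι hequiv
        (congrArg Subtype.val hab))
    · rintro ⟨d, hd⟩
      rw [← himage] at hd
      obtain ⟨c, hc, rfl⟩ := hd
      exact ⟨⟨c, hc⟩, rfl⟩
  exact ⟨AddEquiv.ofBijective f hf, fun c => rfl⟩

end DVRSetting

end Literature.NumberTheory.GaloisCohomology.Howard2004

end
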